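import Literature.NumberTheory.LFunctions.XiIntegral
import Literature.NumberTheory.LFunctions.XiPrimitive
import HarnessLib

/-!
# Bridge: `XiIntegral.lean` ≡ `XiPrimitive.lean` (same object, two concurrent grounder files)

Literature/NumberTheory/LFunctions. On 2026-08-15 two grounders of route NodalHairpin vendored
Lagarias–Montague 2011 independently: `XiPrimitive.lean` (`xiPrimitive`, `lmA0`, `LagariasMontague.F`,
`LagariasMontague2011_thm21_limit`, `Wintner1947_im_xiPrimitive_pos`, `LagariasMontague2011_lemma33_1/2`) and
`XiIntegral.lean` (`xiIntegral`, `xiIntegralLimit`, `lagariasMontagueF`, `LagariasMontague2011_thm_2_1_i/_rate/_ii`,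
`Wintner1947_xiIntegral_im_pos`, `LagariasMontague2011_lem_3_3_i/_ii`, `_sec5_horizontal`, `_sec5_uniform`).
This file records, with proofs, that the duplicated declarations coincide, so that users (and a future
librarian consolidation) may use either name:

* `xiPrimitive = xiIntegral` and `LagariasMontague.F = lagariasMontagueF` — by `rfl`;
* `lmA0 = xiIntegralLimit` — `π · Σ(4π²n⁴ − 6πn²)e^{−πn²} = 2π · deBruijnPhi 0` (termwise, `tsum_mul_left`);
* the duplicated named facts are equivalent (`Iff.rfl` up to the constant identification).

Nothing new is asserted. [folklore]
-/

noncomputable section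

open Complex Real
open _root_.Filter
open scoped _root_.Topology

namespace Literature.NumberTheory.LFunctions

/-- The two vendored names of Lagarias–Montague's `ξ^{(-1)}` agree definitionally. [folklore] -/
theorem xiPrimitive_eq_xiIntegral : xiPrimitive = xiIntegral := rfl

/-- The two vendored names of Lagarias–Montague's comparison function `F(σ,t)` agree definitionally.
[folklore] -/
theorem lagariasMontagueF_eq : LagariasMontague.F = lagariasMontagueF := rfl

/-- `Φ_LM(0) = 2 · deBruijnPhi 0`: Lagarias–Montague's `Φ(0) = Σ (4π²n⁴ − 6πn²) e^{−πn²}` is twice the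
value at `0` of the tree's Rodgers–Tao-normalised kernel. [folklore] -/
theorem lmPhiZero_eq_two_mul_deBruijnPhi_zero : lmPhiZero = 2 * deBruijnPhi 0 := by
  rw [lmPhiZero, deBruijnPhi, ← tsum_mul_left]
  refine tsum_congr fun n => ?_
  simp only [deBruijnPhiSummand, mul_zero, Real.exp_zero, mul_one, neg_mul]
  ring

/-- The two vendored names of the constant `A₀ = πΦ(0) ≈ 2.80668` agree. [folklore] -/
theorem lmA0_eq_xiIntegralLimit : lmA0 = xiIntegralLimit := by
  rw [lmA0, xiIntegralLimit, lmPhiZero_eq_two_mul_deBruijnPhi_zero]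
  ring

/-- Lemma 3.3 (1): the two vendored statements are the same proposition. [folklore] -/
theorem LagariasMontague2011_lemma33_1_iff :
    LagariasMontague2011_lemma33_1 ↔ LagariasMontague2011_lem_3_3_i := Iff.rfl

/-- Lemma 3.3 (2): the two vendored statements are the same proposition. [folklore] -/
theorem LagariasMontague2011_lemma33_2_iff :
    LagariasMontague2011_lemma33_2 ↔ LagariasMontague2011_lem_3_3_ii := Iff.rfl

/-- Wintner 1947: the two vendored statements are the same proposition. [folklore] -/
theorem Wintner1947_im_xiPrimitive_pos_iff :
    Wintner1947_im_xiPrimitive_pos ↔ Wintner1947_xiIntegral_im_pos := Iff.rfl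

/-- Thm. 2.1 (1): the `XiIntegral.lean` version (both limits) gives the `XiPrimitive.lean` version
(the `t → +∞` limit), through `lmA0 = xiIntegralLimit`. [folklore] -/
theorem LagariasMontague2011_thm21_limit_of_thm_2_1_i (h : LagariasMontague2011_thm_2_1_i) :
    LagariasMontague2011_thm21_limit := by
  unfold LagariasMontague2011_thm21_limit
  rw [lmA0_eq_xiIntegralLimit]
  exact h.1

end Literature.NumberTheory.LFunctions
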